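import Summits.QuantumFields.YangMills.Theorems.UnitScaleTiltProp8ChartKernelFlatOrbit
import Summits.QuantumFields.YangMills.Theorems.UnitScaleTiltProp8ChartKernelTower
import Mathlib.Analysis.Calculus.Deriv.Prod
import HarnessLib

/-!
# Route `UnitScaleTilt`, crux K1 «MinimiserStabilityRegPr» (stmt-QuantumFields-19200), stub V2′ `stub_halvingStep`, C_E node after RULING g26-№6 — (S4′) THE ASSEMBLY:
# [Balaban1985Averaging] PROP. 5 (157) FOR THE DOUBLE-BAR CHART — the per-bond kernel of the remainder of `t ↦ −i·log U̿^{(J)}(e^{iη(Y + t·e_b M)})(c)` at `t = 0` beyond its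
# tube part `ηL^J(Q_J e_bM)(c)` is `≤ C·(L^J r₀)·(L^J L^{−Jd})·‖ηM‖` for a fine field of log-size `r₀` (GLOBAL smallness; the weighted-ball∕truncation reading follows), `J`-UNIFORMLY

Cell `ym3-torus` (HUMAN RULING D-0037: YM₃ on the torus is ladder rung R3, not the Clay problem), width seat `ym-ust-19936-w5` gen 3; `--supports stmt-QuantumFields-19200
--as helper`; def-free, 0 sorry.  ★★OWNER ACK 20 (a): «(S4′) GO».

WHY∕HOW.  The (149)–(155) induction is ✓`ChartKernelTower.kernel_tower_bound_le`; its recursion `hrec` is ✓`tower_deriv_recursion` applied to the log-coordinate tower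
`V_0(t) = η(Y + t·e_bM)`, `V_{m+1} = Φ_m(V_m)` (`Φ_m` = ✓`ChartKernelFlat` one step), which COINCIDES with `−i·log U̿^{(m)}(e^{iη(Y+t e_bM)})` for small `t` (round trip ✓`logTower_succ`∕
`logTower_zero` under the sizes ✓`norm_dbarIterU_sub_one_le_two_mul` of (S3) B2 fed by ✓B1); `hT`∕`ha`∕`hSa`∕`hcard` are ✓`ChartKernelTube` (tube `L·Q`, `θ₀ = 2L^{1−d}`,
`θ = 2/L`), `hE` is ✓`norm_fderiv_phiRem_le'` (`G = 2560ℓ/R`, `R = (400ℓ)⁻¹`), `hSk` is locality ✓`dbarIterU_congr_of_agree` ((S4)); sizes `s_m = 16Lᵐr₀` geometric, `α_m = Lᵐ(L^{−d})ᵐ‖ηM‖`.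
WHAT (sizes and the orbit identification are ✓`…ChartKernelFlatOrbit`).  ★★★
`hasDerivAt_logTower_kernel_bound` — for `3 ≤ L`, `J ≤ m_P + K_P`, `0 < r₀ ≤ 1/20`, the k-free windows `121600ℓ²·L^J r₀ ≤ 1`, `51200ℓ·L^J r₀ ≤ 1`, `A′·16L^J r₀ ≤ 1/12`
(`A′ = (2560ℓ/R)·2d/(L²(Lᵈ)⁻¹)`), and `‖ηY_b‖ ≤ r₀` for ALL fine bonds: there is `k` with `HasDerivAt (t ↦ −i·log U̿^{(J)}(e^{iη(Y + t e_{b₀}M)})(c_J)) ((ηL^J)·(Q_J e_{b₀}M)(c_J) + k) 0`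
and **`‖k‖ ≤ (A′/(1 − 2/L − 1/12))·(16L^J r₀)·(L^J(L^{−d})^J‖ηM‖)`** — print's `|δC_k/δA_b| ≤ C₃|A|` with `|A| ↔ L^J r₀` and the tube scale `L^J L^{−Jd}` ((157), flat background,
double-bar chart), `J`-UNIFORM constants in `d, L` only.  (`set_option maxHeartbeats 400000 in` on the assembly theorem per the cell's HEARTBEAT rule; it elaborates in ≈ 15 s.)
HONEST SCOPE.  Generic `Params`, matrix algebras `M_n(ℂ)`; the T³∕weighted-ball∕`IsLevWeight` reading in ✓p608316's `hK` letters (truncation to the read cone by ✓`chartLogFlat_congr`,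
`weighted_read_bound`, hCd♭ of (S3) B2) is the next, last file.  NOT a claim about the stub, the crux, the rung or the mass gap.

References: T. Bałaban, CMP **98** (1985) 17–51 [Balaban1985Averaging] ((147)–(157) pp.40–42); CMP **95** (1984) 17–40 [Balaban1984PropagatorsI] ((1.18) p.20).
-/

noncomputable section

open scoped BigOperators Matrix.Norms.L2Operator
open NormedSpace Metric Filter Topology

namespace Summit.QuantumFields.YangMills.Theorems.ChartKernelFlat

open Literature.MathematicalPhysics.QuantumFieldTheory.Balaban1983to89
open T4Continuum BlockAveraging MatrixLog
open LatticeFieldCalculus (bondAvg bondAvgIter)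
open B5Eq118OneStroke (iterBlockOf)
open Summit.QuantumFields.YangMills.Theorems.Prop8Chart (isUnit_exp_I_eta expCfg coe_expCfg)
open Summit.QuantumFields.YangMills.Theorems.Prop8ChartDoubleBar
open Summit.QuantumFields.YangMills.Theorems.ChartKernelTower
open Summit.QuantumFields.YangMills.Theorems.ChartKernelTube

variable {P : Params}

/-! ## §3 The assembly: Prop. 5 (157) for the double-bar chart, globally small field -/

section Main

variable {n : Type*} [Fintype n] [DecidableEq n] [Nonempty n]

set_option maxHeartbeats 400000 in
/-- ★★★ **[Balaban1985Averaging] PROP. 5 (157) FOR THE DOUBLE-BAR CHART — THE PER-BOND KERNEL OF THE REMAINDER, `J`-UNIFORM.**  `3 ≤ L`, `J ≤ m_P + K_P`; a fine field `Y` and `η` with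
`‖ηY_b‖ ≤ r₀` for ALL fine bonds, `0 < r₀ ≤ 1/20`, windows `121600ℓ²L^J r₀ ≤ 1`, `51200ℓ·L^J r₀ ≤ 1`, `A′·16L^J r₀ ≤ 1/12` with `A′ := (2560ℓ/R)·(2d)/(L²(Lᵈ)⁻¹)`, `R := (400ℓ)⁻¹`;
a fine bond `b₀`, a direction `M`, a level-`J` bond `c_J`.  Then `t ↦ −i·log U̿^{(J)}(e^{iη(Y + t·e_{b₀}M)})(c_J)` has at `t = 0` the derivative `(ηL^J)·(Q_J e_{b₀}M)(c_J) + k` with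
**`‖k‖ ≤ (A′/(1 − 2/L − 1/12))·(16L^J r₀)·(L^J((Lᵈ)⁻¹)^J·‖ηM‖)`** (the linear part is print's tube (147); the bound is (157) `C₃|A|` with the tube scale). [cite: Balaban1985Averaging, (149)-(157) pp.40-42] -/
theorem hasDerivAt_logTower_kernel_bound (hL3 : 3 ≤ P.L) {J : ℕ} (hJ : J ≤ P.m + P.K) (η : ℝ)
    (Y : PBond P 0 → Matrix n n ℂ) (b₀ : PBond P 0) (Mdir : Matrix n n ℂ) (cJ : PBond P J) {r₀ : ℝ} (hr0 : 0 < r₀) (hr : r₀ ≤ 1 / 20)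
    (hY : ∀ b, ‖((η : ℂ) • Y) b‖ ≤ r₀)
    (hbud : 121600 * (((P.d + 2) * P.L : ℕ) : ℝ) ^ 2 * (P.L : ℝ) ^ J * r₀ ≤ 1)
    (hRball : 51200 * (((P.d + 2) * P.L : ℕ) : ℝ) * (P.L : ℝ) ^ J * r₀ ≤ 1)
    (hδ : (2560 * (((P.d + 2) * P.L : ℕ) : ℝ) / (400 * (((P.d + 2) * P.L : ℕ) : ℝ))⁻¹) * (2 * (P.d : ℝ)) /
        ((P.L : ℝ) ^ 2 * ((P.L : ℝ) ^ P.d)⁻¹) * (16 * ((P.L : ℝ) ^ J * r₀)) ≤ 1 / 12) :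
    ∃ k : Matrix n n ℂ,
      ‖k‖ ≤ (2560 * (((P.d + 2) * P.L : ℕ) : ℝ) / (400 * (((P.d + 2) * P.L : ℕ) : ℝ))⁻¹) * (2 * (P.d : ℝ)) /
          ((P.L : ℝ) ^ 2 * ((P.L : ℝ) ^ P.d)⁻¹) / (1 - 2 / (P.L : ℝ) - 1 / 12) *
          (16 * ((P.L : ℝ) ^ J * r₀)) * ((P.L : ℝ) ^ J * (((P.L : ℝ) ^ P.d)⁻¹) ^ J * ‖(η : ℂ) • Mdir‖) ∧
      HasDerivAt (fun t : ℂ => (-Complex.I) • mlog (((dbarIterU J (expCfg η (Y + t • (Pi.single b₀ Mdir : PBond P 0 → Matrix n n ℂ))) cJ :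
          (Matrix n n ℂ)ˣ) : Matrix n n ℂ)))
        (((η : ℂ) * ((P.L : ℕ) : ℂ) ^ J) • bondAvgIter J (Pi.single b₀ Mdir : PBond P 0 → Matrix n n ℂ) cJ + k) 0 := by
  -- letters
  set ℓ : ℝ := (((P.d + 2) * P.L : ℕ) : ℝ) with hℓ
  set Lr : ℝ := (P.L : ℝ) with hLr
  set R : ℝ := (400 * ℓ)⁻¹ with hR
  set G : ℝ := 2560 * ℓ / R with hG
  set lam : ℝ := Lr * (Lr ^ P.d)⁻¹ with hlam
  set θ₀ : ℝ := 2 * Lr * (Lr ^ P.d)⁻¹ with hθ₀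
  set θ : ℝ := 2 / Lr with hθ
  set A' : ℝ := G * (2 * (P.d : ℝ)) / (Lr ^ 2 * (Lr ^ P.d)⁻¹) with hA'
  set s : ℕ → ℝ := fun m => 16 * (Lr ^ m * r₀) with hs
  set α : ℕ → ℝ := fun m => Lr ^ m * ((Lr ^ P.d)⁻¹) ^ m * ‖(η : ℂ) • Mdir‖ with hα
  set E₀ : PBond P 0 → Matrix n n ℂ := Pi.single b₀ Mdir with hE₀
  set D₀ : PBond P 0 → Matrix n n ℂ := (η : ℂ) • E₀ with hD₀
  set V₀ : PBond P 0 → Matrix n n ℂ := (η : ℂ) • Y with hV₀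
  have hL3r : (3 : ℝ) ≤ Lr := by rw [hLr]; exact_mod_cast hL3
  have hL0 : (0 : ℝ) < Lr := by linarith
  have hℓ1 : (1 : ℝ) ≤ ℓ := by
    rw [hℓ]; exact_mod_cast Nat.one_le_iff_ne_zero.mpr (Nat.mul_ne_zero (by omega) P.L_pos.ne')
  have hℓ0 : (0 : ℝ) < ℓ := by linarith
  have hR0 : 0 < R := by rw [hR]; positivity
  have hR400 : 400 * ℓ * R ≤ 1 := by rw [hR]; exact le_of_eq (mul_inv_cancel₀ (by positivity))
  have hG0 : 0 ≤ G := by rw [hG]; positivity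
  have hlam0 : 0 ≤ lam := by rw [hlam]; positivity
  have hA'0 : 0 ≤ A' := by rw [hA']; positivity
  have hθδ : θ + 1 / 12 < 1 := by
    rw [hθ]
    have : 2 / Lr ≤ 2 / 3 := div_le_div_of_nonneg_left (by norm_num) (by norm_num) hL3r
    linarith
  have hs0 : ∀ m, 0 ≤ s m := fun m => by simp only [hs]; positivity
  have hα0 : ∀ m, 0 ≤ α m := fun m => by simp only [hα]; positivity
  have hsL : ∀ m, m < J → Lr * s m ≤ s (m + 1) := fun m _ => by simp only [hs, pow_succ]; nlinarith [le_refl (Lr ^ m * r₀)]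
  have hαL : ∀ m, m < J → α (m + 1) = lam * α m := fun m _ => by simp only [hα, hlam, pow_succ]; ring
  have hθle : θ₀ ≤ θ * (Lr * lam) := by
    rw [hθ₀, hθ, hlam]
    have : 2 / Lr * (Lr * (Lr * (Lr ^ P.d)⁻¹)) = 2 * Lr * (Lr ^ P.d)⁻¹ := by
      calc 2 / Lr * (Lr * (Lr * (Lr ^ P.d)⁻¹)) = (2 / Lr * Lr) * (Lr * (Lr ^ P.d)⁻¹) := by ring
        _ = 2 * (Lr * (Lr ^ P.d)⁻¹) := by rw [div_mul_cancel₀ (2 : ℝ) hL0.ne']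
        _ = 2 * Lr * (Lr ^ P.d)⁻¹ := by ring
    rw [this]
  have hGν : G * ((2 * P.d : ℕ) : ℝ) ≤ A' * (Lr * lam) := by
    rw [hA', hlam]
    have hne : Lr ^ 2 * (Lr ^ P.d)⁻¹ ≠ 0 := by positivity
    have : G * (2 * (P.d : ℝ)) / (Lr ^ 2 * (Lr ^ P.d)⁻¹) * (Lr * (Lr * (Lr ^ P.d)⁻¹)) = G * (2 * (P.d : ℝ)) := by
      rw [show Lr * (Lr * (Lr ^ P.d)⁻¹) = Lr ^ 2 * (Lr ^ P.d)⁻¹ by ring, div_mul_cancel₀ _ hne]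
    rw [this]; push_cast; exact le_rfl
  have hsmono : ∀ m, m ≤ J → s m ≤ 16 * (Lr ^ J * r₀) := fun m hm => by
    simp only [hs]
    have : Lr ^ m ≤ Lr ^ J := pow_le_pow_right₀ (by linarith) hm
    nlinarith [hr0.le]
  have hsmall : ∀ m, m < J → A' * s m ≤ 1 / 12 := fun m hm =>
    (mul_le_mul_of_nonneg_left (hsmono m hm.le) hA'0).trans (by rw [hA', hG]; exact hδ)
  have hsR : ∀ m, m < J → s m < R / 8 := by
    intro m hm
    -- `s m · L ≤ 16 L^J r₀ ≤ R/8`, and `L ≥ 3`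
    have hmJ : Lr ^ m * Lr ≤ Lr ^ J := by
      rw [← pow_succ]; exact pow_le_pow_right₀ (by linarith) hm
    have h16 : 16 * (Lr ^ J * r₀) ≤ R / 8 := by
      rw [hR, le_div_iff₀ (by norm_num : (0 : ℝ) < 8)]
      have : 16 * (Lr ^ J * r₀) * 8 * (400 * ℓ) ≤ 1 := by
        calc 16 * (Lr ^ J * r₀) * 8 * (400 * ℓ) = 51200 * ℓ * Lr ^ J * r₀ := by ring
          _ ≤ 1 := hRball
      calc 16 * (Lr ^ J * r₀) * 8 = 16 * (Lr ^ J * r₀) * 8 * (400 * ℓ) * (400 * ℓ)⁻¹ := by field_simp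
        _ ≤ 1 * (400 * ℓ)⁻¹ := mul_le_mul_of_nonneg_right this (by positivity)
        _ = (400 * ℓ)⁻¹ := one_mul _
    have hsm : s m * Lr ≤ 16 * (Lr ^ J * r₀) := by
      simp only [hs]; nlinarith [mul_le_mul_of_nonneg_right hmJ hr0.le]
    have hpos : 0 ≤ s m := hs0 m
    nlinarith [hR0]
  -- the one steps, the tube, the linear tower, the orbit
  set Φ : (m : ℕ) → (PBond P m → Matrix n n ℂ) → (PBond P (m + 1) → Matrix n n ℂ) := fun m W c =>
    (-Complex.I) • mlog (((dbarAvgU (fun b : PBond P m => (isUnit_exp_I_eta 1 (W b)).unit) c : (Matrix n n ℂ)ˣ) : Matrix n n ℂ)) with hΦ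
  choose T hT using fun m : ℕ => exists_tubeCLM (P := P) (j := m) (V := Matrix n n ℂ)
  have hTapply : ∀ m (w : PBond P m → Matrix n n ℂ) (c : PBond P (m + 1)), T m w c = (P.L : ℝ) • bondAvg w c := fun m w c => by
    rw [hT, tubeCLM_formula_eq_smul_bondAvg]
  let Lin : (m : ℕ) → (PBond P 0 → Matrix n n ℂ) →L[ℂ] (PBond P m → Matrix n n ℂ) := fun m =>
    Nat.rec (motive := fun m => (PBond P 0 → Matrix n n ℂ) →L[ℂ] (PBond P m → Matrix n n ℂ)) (ContinuousLinearMap.id ℂ _) (fun m Lm => (T m).comp Lm) m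
  have hLin0 : Lin 0 = ContinuousLinearMap.id ℂ _ := rfl
  have hLins : ∀ m, Lin (m + 1) = (T m).comp (Lin m) := fun m => rfl
  have hTapplyC : ∀ m (w : PBond P m → Matrix n n ℂ) (c : PBond P (m + 1)), T m w c = ((P.L : ℕ) : ℂ) • bondAvg w c := fun m w c => by
    rw [hTapply, RCLike.real_smul_eq_coe_smul (K := ℂ)]
    congr 1
  have hLin_applyC : ∀ m (w : PBond P 0 → Matrix n n ℂ) (c : PBond P m), Lin m w c = (((P.L : ℕ) : ℂ) ^ m) • bondAvgIter m w c := by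
    intro m
    induction m with
    | zero => intro w c; rw [hLin0, pow_zero, one_smul]; rfl
    | succ m ih =>
      intro w c
      rw [hLins, ContinuousLinearMap.comp_apply, hTapplyC, show bondAvgIter (m + 1) w = bondAvg (bondAvgIter m w) from rfl]
      have hfun : (Lin m w : PBond P m → Matrix n n ℂ) = fun c' => (((P.L : ℕ) : ℂ) ^ m) • bondAvgIter m w c' := funext (ih w)
      rw [hfun, bondAvg_const_smul, smul_smul, pow_succ, mul_comm]
  have hLin_apply : ∀ m (w : PBond P 0 → Matrix n n ℂ) (c : PBond P m), Lin m w c = ((P.L : ℝ) ^ m) • bondAvgIter m w c := fun m w c => by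
    rw [hLin_applyC, RCLike.real_smul_eq_coe_smul (K := ℂ)]
    congr 1
    norm_cast
  let V : (m : ℕ) → ℂ → (PBond P m → Matrix n n ℂ) := fun m =>
    Nat.rec (motive := fun m => ℂ → (PBond P m → Matrix n n ℂ)) (fun t => V₀ + t • D₀) (fun m v t => Φ m (v t)) m
  have hV0 : ∀ t, V 0 t = V₀ + t • D₀ := fun t => rfl
  have hVs : ∀ m t, V (m + 1) t = Φ m (V m t) := fun m t => rfl
  -- the orbit is the log tower near `t = 0`
  have horbit := tower_eq_log η Y b₀ Mdir hr0.le hr hY hJ hbud V (fun t => by rw [hV0 t]) (fun m t => by rw [hVs m t])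
  have ht0 : ‖(0 : ℂ)‖ * ‖(η : ℂ) • Mdir‖ ≤ r₀ := by rw [norm_zero, zero_mul]; exact hr0.le
  have hV0size : ∀ m, m ≤ J → ∀ e : PBond P m, ‖V m 0 e‖ ≤ s m := by
    intro m hm e
    obtain ⟨hVm, hsz⟩ := horbit m hm 0 ht0
    have hhalf : ‖((dbarIterU m (expCfg η (Y + (0 : ℂ) • (Pi.single b₀ Mdir : PBond P 0 → Matrix n n ℂ))) e : (Matrix n n ℂ)ˣ) : Matrix n n ℂ) - 1‖ ≤ 1 / 2 := by
      refine (hsz e).trans ?_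
      have hLm : Lr ^ m * r₀ ≤ Lr ^ J * r₀ := mul_le_mul_of_nonneg_right (pow_le_pow_right₀ (by linarith) hm) hr0.le
      have h0 : 0 ≤ Lr ^ J * r₀ := by positivity
      have h1 : Lr ^ J * r₀ ≤ ℓ * (Lr ^ J * r₀) := by have := mul_le_mul_of_nonneg_right hℓ1 h0; linarith
      have h2 : 51200 * (ℓ * (Lr ^ J * r₀)) ≤ 1 := by
        calc 51200 * (ℓ * (Lr ^ J * r₀)) = 51200 * ℓ * Lr ^ J * r₀ := by ring
          _ ≤ 1 := hRball
      show 8 * ((P.L : ℝ) ^ m * r₀) ≤ 1 / 2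
      rw [← hLr]; linarith
    rw [hVm]
    show ‖(-Complex.I) • mlog _‖ ≤ s m
    rw [norm_smul, norm_neg, Complex.norm_I, one_mul]
    calc _ ≤ 2 * ‖((dbarIterU m (expCfg η (Y + (0 : ℂ) • (Pi.single b₀ Mdir : PBond P 0 → Matrix n n ℂ))) e : (Matrix n n ℂ)ˣ) : Matrix n n ℂ) - 1‖ :=
          norm_mlog_le_two_mul hhalf
      _ ≤ 2 * (8 * ((P.L : ℝ) ^ m * r₀)) := by linarith [hsz e]
      _ = s m := by simp only [hs, hLr]; ring
  -- differentiability of the one steps at the orbit points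
  have hΦdiff : ∀ m, m < J → DifferentiableAt ℂ (Φ m) (V m 0) := by
    intro m hm
    have hm1 : m + 1 ≤ P.m + P.K := by omega
    refine differentiableAt_pi.2 fun c => ?_
    exact differentiableAt_phi_of_readBall hm1 c hR0 hR400 (W := V m 0) fun b _ _ =>
      (hV0size m hm.le b).trans_lt ((hsR m hm).trans (by linarith))
  obtain ⟨vd, hder, hk0, hrec⟩ := tower_deriv_recursion (fun m => PBond P m) J Φ T Lin hLin0 hLins V V₀ D₀ hV0 hVs hΦdiff
  -- reader sets of the perturbed bond at every level
  set S : (m : ℕ) → Finset (PBond P m) := fun m => Finset.univ.filter fun c' : PBond P m =>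
      (iterBlockOf m b₀.src = c'.src ∨ iterBlockOf m b₀.src = c'.tgt) ∧ (iterBlockOf m b₀.tgt = c'.src ∨ iterBlockOf m b₀.tgt = c'.tgt) with hSdef
  have hmemS : ∀ m (c' : PBond P m), c' ∈ S m ↔
      (iterBlockOf m b₀.src = c'.src ∨ iterBlockOf m b₀.src = c'.tgt) ∧ (iterBlockOf m b₀.tgt = c'.src ∨ iterBlockOf m b₀.tgt = c'.tgt) := fun m c' => by
    rw [hSdef]; simp
  have hSend : ∀ m, ∀ c' ∈ S m, c'.src = iterBlockOf m b₀.src ∨ c'.tgt = iterBlockOf m b₀.src := fun m c' hc' => by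
    rcases ((hmemS m c').1 hc').1 with h | h
    · exact Or.inl h.symm
    · exact Or.inr h.symm
  -- the remainder and tube responses
  set k : (m : ℕ) → PBond P m → Matrix n n ℂ := fun m => vd m - Lin m D₀ with hk
  set a : (m : ℕ) → PBond P m → Matrix n n ℂ := fun m c' => Lin m D₀ c' with ha
  have hD₀single : D₀ = Pi.single b₀ ((η : ℂ) • Mdir) := by
    funext b
    by_cases hb : b = b₀
    · subst hb; simp [hD₀, hE₀]
    · simp [hD₀, hE₀, Pi.single_eq_of_ne hb]
  have ha_eq : ∀ m (c' : PBond P m), a m c' = ((P.L : ℝ) ^ m) • bondAvgIter m (Pi.single b₀ ((η : ℂ) • Mdir)) c' := fun m c' => by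
    simp only [ha]; rw [hLin_apply, hD₀single]
  -- the abstract induction
  have hmain := kernel_tower_bound_le J (fun m => PBond P m) k a (fun m w c => T m w c)
    (fun m w c => fderiv ℂ (fun W => Φ m W - T m W) (V m 0) w c) S s α (θ₀ := θ₀) (G := G) (L := Lr) (lam := lam) (θ := θ) (A' := A') (δ := 1 / 12)
    (ν := 2 * P.d) hA'0 hθδ hlam0 hL0.le hG0 hs0 hα0 hsL hαL hθle hGν hsmall
    (fun c => congrFun hk0 c)
    (fun m hm c _ => hrec m hm c)
    (fun m hm c _ w β hβ hw hwβ => by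
      have hm1 : m + 1 ≤ P.m + P.K := by omega
      show ‖T m w c‖ ≤ θ₀ * β
      rw [hTapply]
      exact norm_tube_le_of_endpoint hm1 (iterBlockOf m b₀.src) (S m) (hSend m) w hw hβ hwβ c)
    (fun m hm c _ w hw => by
      have hm1 : m + 1 ≤ P.m + P.K := by omega
      -- component extraction
      have hf : DifferentiableAt ℂ (fun W => Φ m W - T m W) (V m 0) := (hΦdiff m hm).sub (T m).differentiableAt
      have hcomp : fderiv ℂ (fun W => Φ m W - T m W) (V m 0) w c = fderiv ℂ (fun W => (Φ m W - T m W) c) (V m 0) w := by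
        rw [((hasFDerivAt_pi'.mp hf.hasFDerivAt) c).fderiv, ContinuousLinearMap.comp_apply, ContinuousLinearMap.proj_apply]
      have hfun : (fun W : PBond P m → Matrix n n ℂ => (Φ m W - T m W) c) = fun W =>
          (-Complex.I) • mlog (((dbarAvgU (fun b : PBond P m => (isUnit_exp_I_eta 1 (W b)).unit) c : (Matrix n n ℂ)ˣ) : Matrix n n ℂ)) -
            ((P.L : ℕ) : ℂ) • bondAvg W c := by
        funext W
        rw [Pi.sub_apply, hTapplyC]
      show ‖fderiv ℂ (fun W => Φ m W - T m W) (V m 0) w c‖ ≤ G * s m * ∑ c' ∈ S m, ‖w c'‖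
      rw [hcomp, hfun]
      have h148 := norm_fderiv_phiRem_le' (n := n) hm1 c hR0 hR400 (s := s m) (hs0 m) (hsR m hm) (V := V m 0) (fun b _ _ => hV0size m hm.le b) w
      refine h148.trans ?_
      have hsum := sum_norm_le_of_vanish (S m)
        (Finset.univ.filter fun b : PBond P m => (blockOf b.src = c.src ∨ blockOf b.src = c.tgt) ∧ (blockOf b.tgt = c.src ∨ blockOf b.tgt = c.tgt)) w hw
      have hGs : 0 ≤ 2560 * ℓ / R * s m := mul_nonneg (by positivity) (hs0 m)
      calc 2560 * ℓ / R * s m * ∑ b ∈ Finset.univ.filter (fun b : PBond P m => (blockOf b.src = c.src ∨ blockOf b.src = c.tgt) ∧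
            (blockOf b.tgt = c.src ∨ blockOf b.tgt = c.tgt)), ‖w b‖ ≤ 2560 * ℓ / R * s m * ∑ c' ∈ S m, ‖w c'‖ := mul_le_mul_of_nonneg_left hsum hGs
        _ = G * s m * ∑ c' ∈ S m, ‖w c'‖ := by rw [hG])
    (fun m _ => card_le_two_mul_d_of_endpoint (iterBlockOf m b₀.src) (S m) (hSend m))
    (fun m hm c' hc' => by
      have hmK : m ≤ P.m + P.K := by omega
      show a m c' = 0
      rw [ha_eq]
      exact iterTube_single_eq_zero_of_not_reads hmK b₀ ((η : ℂ) • Mdir) c' fun h => hc' ((hmemS m c').2 h))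
    (fun m hm c' hc' => by
      -- `k m c' = V̇_m(c') − a_m(c')`; both vanish off the readers: `a` by the tube's support, `V̇` because the orbit is constant in `t` there
      have hmK : m ≤ P.m + P.K := hm.trans hJ
      have ha0 : a m c' = 0 := by
        rw [ha_eq]; exact iterTube_single_eq_zero_of_not_reads hmK b₀ ((η : ℂ) • Mdir) c' fun h => hc' ((hmemS m c').2 h)
      have hnot : ¬ ((iterBlockOf m b₀.src = c'.src ∨ iterBlockOf m b₀.src = c'.tgt) ∧ (iterBlockOf m b₀.tgt = c'.src ∨ iterBlockOf m b₀.tgt = c'.tgt)) :=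
        fun h => hc' ((hmemS m c').2 h)
      -- the orbit component is constant near `0`
      have hnbhd : ∀ᶠ t : ℂ in 𝓝 0, V m t c' = V m 0 c' := by
        have hpos : 0 < r₀ / (‖(η : ℂ) • Mdir‖ + 1) := by positivity
        filter_upwards [Metric.ball_mem_nhds (0 : ℂ) hpos] with t ht
        rw [mem_ball_zero_iff] at ht
        have ht' : ‖t‖ * ‖(η : ℂ) • Mdir‖ ≤ r₀ := by
          have h1 : ‖t‖ * ‖(η : ℂ) • Mdir‖ ≤ ‖t‖ * (‖(η : ℂ) • Mdir‖ + 1) := mul_le_mul_of_nonneg_left (by linarith) (norm_nonneg _)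
          have h2 : ‖t‖ * (‖(η : ℂ) • Mdir‖ + 1) < r₀ := by rwa [lt_div_iff₀ (by positivity)] at ht
          linarith
        obtain ⟨hVt, -⟩ := horbit m hm t ht'
        obtain ⟨hV0', -⟩ := horbit m hm 0 ht0
        rw [hVt, hV0']
        show (-Complex.I) • mlog _ = (-Complex.I) • mlog _
        rw [dbarIterU_congr_of_agree m hmK c' (U := expCfg η (Y + t • (Pi.single b₀ Mdir : PBond P 0 → Matrix n n ℂ)))
          (U' := expCfg η (Y + (0 : ℂ) • (Pi.single b₀ Mdir : PBond P 0 → Matrix n n ℂ))) fun b hbs hbt => ?_]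
        have hb : b ≠ b₀ := by rintro rfl; exact hnot ⟨hbs, hbt⟩
        apply Units.ext
        rw [coe_expCfg, coe_expCfg, Pi.add_apply, Pi.add_apply, Pi.smul_apply, Pi.smul_apply, Pi.single_eq_of_ne hb, smul_zero, smul_zero]
      have hconst : HasDerivAt (fun t : ℂ => V m t c') 0 0 :=
        (hasDerivAt_const (0 : ℂ) (V m 0 c')).congr_of_eventuallyEq hnbhd
      have hcomp : HasDerivAt (fun t : ℂ => V m t c') (vd m c') 0 := (hasDerivAt_pi.mp (hder m hm)) c'
      have hvd0 : vd m c' = 0 := hcomp.unique hconst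
      show (vd m - Lin m D₀) c' = 0
      rw [Pi.sub_apply, hvd0, zero_sub, neg_eq_zero]
      exact ha0)
    (fun m hm c' _ => by
      have hmK : m ≤ P.m + P.K := by omega
      show ‖a m c'‖ ≤ α m
      rw [ha_eq]
      exact norm_iterTube_single_le hmK b₀ ((η : ℂ) • Mdir) c')
  -- extraction at the top
  refine ⟨k J cJ, ?_, ?_⟩
  · have h := hmain J le_rfl cJ
    simp only [hs, hα, hA', hG, hR, hθ, hLr, hℓ] at h
    convert h using 2
  · have htop : HasDerivAt (fun t : ℂ => V J t cJ) (vd J cJ) 0 := (hasDerivAt_pi.mp (hder J le_rfl)) cJ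
    have hnbhd : ∀ᶠ t : ℂ in 𝓝 0, V J t cJ = (-Complex.I) • mlog (((dbarIterU J (expCfg η (Y + t • (Pi.single b₀ Mdir : PBond P 0 → Matrix n n ℂ))) cJ :
        (Matrix n n ℂ)ˣ) : Matrix n n ℂ)) := by
      have hpos : 0 < r₀ / (‖(η : ℂ) • Mdir‖ + 1) := by positivity
      filter_upwards [Metric.ball_mem_nhds (0 : ℂ) hpos] with t ht
      rw [mem_ball_zero_iff] at ht
      have ht' : ‖t‖ * ‖(η : ℂ) • Mdir‖ ≤ r₀ := by
        have h1 : ‖t‖ * ‖(η : ℂ) • Mdir‖ ≤ ‖t‖ * (‖(η : ℂ) • Mdir‖ + 1) := mul_le_mul_of_nonneg_left (by linarith) (norm_nonneg _)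
        have h2 : ‖t‖ * (‖(η : ℂ) • Mdir‖ + 1) < r₀ := by rwa [lt_div_iff₀ (by positivity)] at ht
        linarith
      obtain ⟨hVt, -⟩ := horbit J le_rfl t ht'
      rw [hVt]
    have hderiv := htop.congr_of_eventuallyEq (hnbhd.mono fun t h => h.symm)
    have hvd : vd J cJ = ((η : ℂ) * ((P.L : ℕ) : ℂ) ^ J) • bondAvgIter J (Pi.single b₀ Mdir : PBond P 0 → Matrix n n ℂ) cJ + k J cJ := by
      have h1 : vd J cJ = a J cJ + k J cJ := by simp only [hk, ha, Pi.sub_apply]; abel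
      rw [h1, ha_eq]
      congr 1
      rw [show (Pi.single b₀ ((η : ℂ) • Mdir) : PBond P 0 → Matrix n n ℂ) = fun b => (η : ℂ) • (Pi.single b₀ Mdir : PBond P 0 → Matrix n n ℂ) b from ?_,
        bondAvgIter_const_smul, RCLike.real_smul_eq_coe_smul (K := ℂ), smul_smul]
      · congr 1; push_cast; ring
      · funext b
        by_cases hb : b = b₀
        · subst hb; simp
        · simp [Pi.single_eq_of_ne hb]
    rw [hvd] at hderiv
    exact hderiv

end Main

end Summit.QuantumFields.YangMills.Theorems.ChartKernelFlat

end
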